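import Summits.CriticalPhenomena.PercolationContinuityZ3.Theorems.Transplant.SkelPhiNegReachHolds
import Summits.CriticalPhenomena.PercolationContinuityZ3.Theorems.Transplant.SkelNegBParamsResiduals
import HarnessLib

/-!
# N1 (the `{±1}` node), (C) column (C-A8, unconditional form): **`ReachHoldsRHNOFn` OF THE CHOICE FUNCTION OF RECORD AT THE RESIDUAL
# OF RECORD `NegB.exR`** — `PlanarSkeletonNeg.reachHoldsRHNOFn_negChoiceAllOT_exR`: for kit index `0`, ANY box/width residuals `gx fx`, any extra
# pairs `Px`, any excess-diameter residual `mx`, `ReachHoldsRHNOFn (negChoiceAllOT (KS.gT 0 gx) (KS.fT 0 fx) (KS.PR 0 Px) (NegB.SU NegB.exR mx))` —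
# NO HYPOTHESES: the two `ex`-floors of `reachHoldsRHNOFn_negChoiceAllOT` (`r₀A(R_l) + 3 ≤ ex`, `4 + 13·800·(n_L + W_B) ≤ ex`) hold at stmt-g14's
# `NegB.exR` (SkelNegBParamsResiduals: a sum containing `KS.r₀A Φ t D 0 (Rl …)`, `exC = 1 + 13·800·(n_L + Wrun) + 3` and `+ 10`; `KS.Wrun = CorrRec.Qw`
# and `NegB.Rl = D.R (D.scale t M_L n_L)` by `rfl`). In particular at the node's residuals of record `(gxR, fxR, mxR)`:
# `reachHoldsRHNOFn_negChoiceAllOT_R`.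

builds on p205010 (kernel theorem, internal audit signed; external expert review pending) — nothing in this file uses p205010; NOTHING is claimed about the
open node `SamePDropOfSkeletonNeg`: this is its (C) hypothesis for the choice function of record, now unconditional.
Lane `prim-bschramm`, seat `prim-bschramm-p5` (gen 9; (C) lineage); helper file (`--supports stmt-CriticalPhenomena-4575 --as helper`).
[cite: KozmaNitzan2024, §4 Theorem 6 (pp. 25–31), Lemmas 10–12 (pp. 17–25)] [cite: MartineauTassion2017, §4.3 Lemma 4.2]
-/

noncomputable section

open scoped Classical

namespace Summit.CriticalPhenomena.PercolationContinuityZ3.Theorems.Transplant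

namespace PlanarSkeletonNeg

open SkelConc (Consts)
open Skelφ.StepI (DataN)

/-- **`ReachHoldsRHNOFn (negChoiceAllOT (KS.gT 0 gx) (KS.fT 0 fx) (KS.PR 0 Px) (NegB.SU NegB.exR mx))`** for all residuals `gx fx Px mx` — unconditional.
[cite: KozmaNitzan2024, §4 Theorem 6 (pp. 25–31), Lemmas 10–12] -/
theorem reachHoldsRHNOFn_negChoiceAllOT_exR (gx fx : Neg.FSlot) (Px : NegB.PSlot) (mx : NegB.GSlot) :
    ReachHoldsRHNOFn (negChoiceAllOT (NegB.KS.gT 0 gx) (NegB.KS.fT 0 fx) (NegB.KS.PR 0 Px) (NegB.SU NegB.exR mx)) := by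
  refine reachHoldsRHNOFn_negChoiceAllOT 0 gx fx Px NegB.exR mx ?_
  intro κ V _ _ G _ Φ t p D
  constructor
  · change NegB.KS.r₀A Φ t D 0 (NegB.Rl κ Φ t p D (NegB.KS.gT 0 gx κ Φ t p D) (NegB.KS.fT 0 fx κ Φ t p D)) + 3 ≤
      NegB.exR κ Φ t p D (NegB.KS.gT 0 gx κ Φ t p D) (NegB.KS.fT 0 fx κ Φ t p D)
    simp only [NegB.exR]
    omega
  · change 4 + 13 * (800 * (NegB.nL κ Φ t p D (NegB.KS.gT 0 gx κ Φ t p D) (NegB.KS.fT 0 fx κ Φ t p D) +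
        NegB.KS.Wrun κ Φ t p D (NegB.KS.gT 0 gx κ Φ t p D) (NegB.KS.fT 0 fx κ Φ t p D))) ≤
      NegB.exR κ Φ t p D (NegB.KS.gT 0 gx κ Φ t p D) (NegB.KS.fT 0 fx κ Φ t p D)
    simp only [NegB.exR, NegB.exC]
    omega

/-- **THE (C) HYPOTHESIS OF THE NODE AT THE RESIDUALS OF RECORD** `(gxR, fxR, exR, mxR)` (kit index `0`, any extra pairs `Px`):
`ReachHoldsRHNOFn (negChoiceAllOT (KS.gT 0 gxR) (KS.fT 0 fxR) (KS.PR 0 Px) (NegB.SU exR mxR))`. [cite: KozmaNitzan2024, §4 Theorem 6 (pp. 25–31)] -/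
theorem reachHoldsRHNOFn_negChoiceAllOT_R (Px : NegB.PSlot) :
    ReachHoldsRHNOFn (negChoiceAllOT (NegB.KS.gT 0 NegB.gxR) (NegB.KS.fT 0 NegB.fxR) (NegB.KS.PR 0 Px) (NegB.SU NegB.exR NegB.mxR)) :=
  reachHoldsRHNOFn_negChoiceAllOT_exR NegB.gxR NegB.fxR Px NegB.mxR

end PlanarSkeletonNeg

end Summit.CriticalPhenomena.PercolationContinuityZ3.Theorems.Transplant

end
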